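import Mathlib.Data.Finset.Sups
import Mathlib.Data.Nat.Choose.Sum
import Mathlib.Data.Matrix.Block
import Mathlib.LinearAlgebra.Matrix.Block
import Mathlib.LinearAlgebra.Matrix.Determinant.Basic
import Mathlib.Order.UpperLower.Basic

/-!
# `NoHeavyLowerTail` (crux stmt-CriticalPhenomena-4575), lane prim-ineq-gen-4 (gen 21): the determinant criterion for the anti-band inequality —
# the covering matrix of an up-set of the anti-band is non-singular iff the binomial matrix `[C(y−1−#(x∪x'), k)]` on its small members is

Support file (`--supports stmt-CriticalPhenomena-4575`; memo `run/shared/lean/prim/prim-ineq-gen-4/FINDING-DET-CRITERION-g21.md` §1 (iii)–(v)).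
Pure finite combinatorics / matrix algebra over `ℤ`, no definitions, no `sorry`, standard axioms.

Setting (memo §1).  `U` is a family of finsets of size `≤ k` ("small members"), `D` a lower set of finsets of size `≤ k` containing every small set disjoint from some
member of `U`, and `2k+2 ≤ |β|`.  The covering matrix of `W = U ⊔ {dᶜ : d ∈ D}` (`[s ∪ t = univ]`) is, in block form, `C = [[0, Kᵀ],[K, Disj]]` with `K[d,x] = [d ⊆ x]`,
`Disj[d,d'] = [d ∩ d' = ∅]`.  With `Zs[u,d] = (−1)^{#u}[u ⊆ d]`, `S = diag (−1)^{#u}`, `N[u,x] = [u ∩ x = ∅]` (all indexed by `D`, resp. `D × U`):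
`K = Zsᵀ N`, `Disj = Zsᵀ S Zs` (inclusion–exclusion inside the lower set `D`), so `C = Rᵀ X R` with `R = 1 ⊕ Zs`, `X = [[0, Nᵀ],[N, S]]`, and
`[[1, −NᵀS],[0, 1]] X = [[−NᵀSN, 0],[N, S]]`; finally `(NᵀSN)[x,x'] = Σ_{u ∈ D, u ∩ (x∪x') = ∅} (−1)^{#u} = Σ_{i ≤ k} (−1)^i C(|β|−#(x∪x'), i) = (−1)^k C(|β|−1−#(x∪x'), k)`.
Hence `det C = ± det(Zs)² · det [C(|β|−1−#(x∪x'), k)]` with `det Zs = ±1` (block-triangular by cardinality), so `det C ≠ 0` iff the binomial matrix is non-singular.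

Main statement: `det_coveringBlocks_ne_zero_of_det_binomial_ne_zero`.
-/

namespace Summit.CriticalPhenomena.PercolationContinuityZ3.Theorems.AntiBandCoveringDet

open Finset Matrix

variable {β : Type*} [DecidableEq β] [Fintype β]

omit [Fintype β] in
/-- In a lower set `D` of finsets, the members contained in `t ∈ D` are exactly the subsets of `t`. [elementary] -/
theorem filter_subset_eq_powerset {D : Finset (Finset β)} (hD : IsLowerSet (D : Set (Finset β))) {t : Finset β}
    (ht : t ∈ D) : D.filter (fun u => u ⊆ t) = t.powerset := by
  ext u
  simp only [mem_filter, mem_powerset]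
  constructor
  · exact fun h => h.2
  · exact fun h => ⟨Finset.mem_coe.1 (hD h (Finset.mem_coe.2 ht)), h⟩

omit [Fintype β] in
/-- Inclusion–exclusion inside a lower set: `∑_{u ∈ D, u ⊆ t} (−1)^{#u} = [t = ∅]` for `t ∈ D`. [elementary] -/
theorem sum_neg_one_pow_filter_subset {D : Finset (Finset β)} (hD : IsLowerSet (D : Set (Finset β))) {t : Finset β}
    (ht : t ∈ D) : ∑ u ∈ D.filter (fun u => u ⊆ t), (-1 : ℤ) ^ #u = if t = ∅ then 1 else 0 := by
  rw [filter_subset_eq_powerset hD ht, Finset.sum_powerset_neg_one_pow_card]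

/-- A truncated alternating sum of binomial coefficients: `∑_{m ≤ N} C(N,m)·[m ≤ k](−1)^m = ∑_{m ≤ k} (−1)^m C(N,m)`. [elementary] -/
theorem sum_range_choose_mul_ite (N k : ℕ) :
    ∑ m ∈ range (N + 1), ((N.choose m : ℤ) * if m ≤ k then (-1 : ℤ) ^ m else 0)
      = ∑ m ∈ range (k + 1), (-1 : ℤ) ^ m * (N.choose m : ℤ) := by
  have h1 : ∑ m ∈ range (N + 1), ((N.choose m : ℤ) * if m ≤ k then (-1 : ℤ) ^ m else 0)
      = ∑ m ∈ range (N + k + 2), (if m ≤ k then (-1 : ℤ) ^ m * (N.choose m : ℤ) else 0) := by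
    apply Finset.sum_subset_zero_on_sdiff
    · exact range_subset_range.2 (by omega)
    · intro m hm
      rw [mem_sdiff, mem_range, mem_range] at hm
      have : N.choose m = 0 := Nat.choose_eq_zero_of_lt (by omega)
      simp [this]
    · intro m _
      split_ifs <;> ring
  have h2 : ∑ m ∈ range (k + 1), (-1 : ℤ) ^ m * (N.choose m : ℤ)
      = ∑ m ∈ range (N + k + 2), (if m ≤ k then (-1 : ℤ) ^ m * (N.choose m : ℤ) else 0) := by
    apply Finset.sum_subset_zero_on_sdiff
    · exact range_subset_range.2 (by omega)
    · intro m hm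
      rw [mem_sdiff, mem_range, mem_range] at hm
      have : ¬ m ≤ k := by omega
      simp [this]
    · intro m hm
      rw [mem_range] at hm
      have : m ≤ k := by omega
      simp [this]
  rw [h1, h2]

omit [DecidableEq β] [Fintype β] in
/-- The truncated alternating sum over the subsets of size `≤ k` of a non-empty finset `t`: `∑_{u ⊆ t, #u ≤ k} (−1)^{#u} = (−1)^k C(#t − 1, k)`. [elementary] -/
theorem sum_neg_one_pow_powerset_card_le (t : Finset β) (k : ℕ) (ht : t.Nonempty) :
    ∑ u ∈ t.powerset.filter (fun u => #u ≤ k), (-1 : ℤ) ^ #u = (-1 : ℤ) ^ k * ((#t - 1).choose k : ℤ) := by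
  rw [Finset.sum_filter]
  have h := Finset.sum_powerset_apply_card (fun m => if m ≤ k then (-1 : ℤ) ^ m else 0) (x := t)
  simp only [nsmul_eq_mul] at h
  rw [h, sum_range_choose_mul_ite]
  obtain ⟨n, hn⟩ : ∃ n, #t = n + 1 := ⟨#t - 1, by have := ht.card_pos; omega⟩
  rw [hn, Int.alternating_sum_range_choose_eq_choose]
  simp

omit [Fintype β] in
/-- `K = Zsᵀ N`: for `d ∈ D` (lower set) and any `x`, `∑_{u ∈ D} (−1)^{#u}[u ⊆ d][u ∩ x = ∅] = [d ⊆ x]`. [memo §1(iv)] -/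
theorem zetaSigned_transpose_mul_disj (U D : Finset (Finset β)) (hD : IsLowerSet (D : Set (Finset β))) :
    (Matrix.of fun (u : ↥D) (d : ↥D) => if (u : Finset β) ⊆ d then (-1 : ℤ) ^ #(u : Finset β) else 0)ᵀ *
      (Matrix.of fun (u : ↥D) (x : ↥U) => if Disjoint (u : Finset β) x then (1 : ℤ) else 0)
      = Matrix.of fun (d : ↥D) (x : ↥U) => if (d : Finset β) ⊆ x then (1 : ℤ) else 0 := by
  ext d x
  simp only [mul_apply, transpose_apply, of_apply]
  have hmem : (d : Finset β) \ (x : Finset β) ∈ D :=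
    Finset.mem_coe.1 (hD (Finset.sdiff_subset : (d : Finset β) \ x ⊆ d) (Finset.mem_coe.2 d.2))
  calc ∑ u : ↥D, ((if (u : Finset β) ⊆ d then (-1 : ℤ) ^ #(u : Finset β) else 0) *
            (if Disjoint (u : Finset β) x then (1 : ℤ) else 0))
      = ∑ u ∈ D, ((if u ⊆ d then (-1 : ℤ) ^ #u else 0) * (if Disjoint u (x : Finset β) then (1 : ℤ) else 0)) := by
        rw [univ_eq_attach]
        exact Finset.sum_attach D (fun u => (if u ⊆ (d : Finset β) then (-1 : ℤ) ^ #u else 0) *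
          (if Disjoint u (x : Finset β) then (1 : ℤ) else 0))
    _ = ∑ u ∈ D, (if u ⊆ (d : Finset β) \ x then (-1 : ℤ) ^ #u else 0) := by
        apply Finset.sum_congr rfl
        intro u _
        by_cases h1 : u ⊆ (d : Finset β) <;> by_cases h2 : Disjoint u (x : Finset β)
        · have h3 : u ⊆ (d : Finset β) \ x := Finset.subset_sdiff.2 ⟨h1, h2⟩
          simp [h1, h2, h3]
        · have h3 : ¬ u ⊆ (d : Finset β) \ x := fun h => h2 (Finset.subset_sdiff.1 h).2
          simp [h1, h2, h3]
        · have h3 : ¬ u ⊆ (d : Finset β) \ x := fun h => h1 (Finset.subset_sdiff.1 h).1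
          simp [h1, h2, h3]
        · have h3 : ¬ u ⊆ (d : Finset β) \ x := fun h => h1 (Finset.subset_sdiff.1 h).1
          simp [h1, h2, h3]
    _ = ∑ u ∈ D.filter (fun u => u ⊆ (d : Finset β) \ x), (-1 : ℤ) ^ #u := (Finset.sum_filter _ _).symm
    _ = if (d : Finset β) \ x = ∅ then 1 else 0 := sum_neg_one_pow_filter_subset hD hmem
    _ = if (d : Finset β) ⊆ x then 1 else 0 := if_congr Finset.sdiff_eq_empty_iff_subset rfl rfl

omit [Fintype β] in
/-- `Disj = Zsᵀ S Zs`: for `d, d' ∈ D` (lower set), `∑_{u ∈ D} (−1)^{#u}[u ⊆ d][u ⊆ d'] = [d ∩ d' = ∅]`. [memo §1(iv)] -/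
theorem zetaSigned_transpose_mul_sign_mul_zetaSigned (D : Finset (Finset β)) (hD : IsLowerSet (D : Set (Finset β))) :
    (Matrix.of fun (u : ↥D) (d : ↥D) => if (u : Finset β) ⊆ d then (-1 : ℤ) ^ #(u : Finset β) else 0)ᵀ *
      (Matrix.diagonal fun (u : ↥D) => (-1 : ℤ) ^ #(u : Finset β)) *
      (Matrix.of fun (u : ↥D) (d : ↥D) => if (u : Finset β) ⊆ d then (-1 : ℤ) ^ #(u : Finset β) else 0)
      = Matrix.of fun (d : ↥D) (d' : ↥D) => if Disjoint (d : Finset β) d' then (1 : ℤ) else 0 := by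
  ext d d'
  rw [Matrix.mul_apply]
  simp only [Matrix.mul_diagonal, transpose_apply, of_apply]
  have hmem : (d : Finset β) ∩ (d' : Finset β) ∈ D :=
    Finset.mem_coe.1 (hD (Finset.inter_subset_left : (d : Finset β) ∩ d' ⊆ d) (Finset.mem_coe.2 d.2))
  have hsq : ∀ u : Finset β, (-1 : ℤ) ^ #u * (-1 : ℤ) ^ #u = 1 := fun u => by
    rw [← mul_pow]; norm_num
  calc ∑ u : ↥D, ((if (u : Finset β) ⊆ d then (-1 : ℤ) ^ #(u : Finset β) else 0) * (-1 : ℤ) ^ #(u : Finset β) *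
            (if (u : Finset β) ⊆ d' then (-1 : ℤ) ^ #(u : Finset β) else 0))
      = ∑ u ∈ D, ((if u ⊆ (d : Finset β) then (-1 : ℤ) ^ #u else 0) * (-1 : ℤ) ^ #u *
            (if u ⊆ (d' : Finset β) then (-1 : ℤ) ^ #u else 0)) := by
        rw [univ_eq_attach]
        exact Finset.sum_attach D (fun u => (if u ⊆ (d : Finset β) then (-1 : ℤ) ^ #u else 0) * (-1 : ℤ) ^ #u *
            (if u ⊆ (d' : Finset β) then (-1 : ℤ) ^ #u else 0))
    _ = ∑ u ∈ D, (if u ⊆ (d : Finset β) ∩ d' then (-1 : ℤ) ^ #u else 0) := by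
        apply Finset.sum_congr rfl
        intro u _
        by_cases h1 : u ⊆ (d : Finset β) <;> by_cases h2 : u ⊆ (d' : Finset β)
        · have h3 : u ⊆ (d : Finset β) ∩ d' := Finset.subset_inter h1 h2
          simp [h1, h2, h3, hsq u]
        · have h3 : ¬ u ⊆ (d : Finset β) ∩ d' := fun h => h2 (h.trans Finset.inter_subset_right)
          simp [h1, h2, h3]
        · have h3 : ¬ u ⊆ (d : Finset β) ∩ d' := fun h => h1 (h.trans Finset.inter_subset_left)
          simp [h1, h2, h3]
        · have h3 : ¬ u ⊆ (d : Finset β) ∩ d' := fun h => h1 (h.trans Finset.inter_subset_left)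
          simp [h1, h2, h3]
    _ = ∑ u ∈ D.filter (fun u => u ⊆ (d : Finset β) ∩ d'), (-1 : ℤ) ^ #u := (Finset.sum_filter _ _).symm
    _ = if (d : Finset β) ∩ d' = ∅ then 1 else 0 := sum_neg_one_pow_filter_subset hD hmem
    _ = if Disjoint (d : Finset β) d' then 1 else 0 := if_congr Finset.disjoint_iff_inter_eq_empty.symm rfl rfl

/-- `NᵀSN = (−1)^k · [C(|β|−1−#(x∪x'), k)]`: for small `x, x' ∈ U`, `∑_{u ∈ D} (−1)^{#u}[u∩x = ∅][u∩x' = ∅] = (−1)^k C(|β|−1−#(x∪x'), k)`, because the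
members of `D` disjoint from `x ∪ x'` are exactly the subsets of `(x ∪ x')ᶜ` of size `≤ k`. [memo §1(v)] -/
theorem disj_transpose_mul_sign_mul_disj (k : ℕ) (U D : Finset (Finset β)) (hDk : ∀ d ∈ D, #d ≤ k)
    (hsh : ∀ u : Finset β, #u ≤ k → ∀ x ∈ U, Disjoint u x → u ∈ D) (hUk : ∀ x ∈ U, #x ≤ k)
    (hβ : 2 * k + 2 ≤ Fintype.card β) :
    (Matrix.of fun (u : ↥D) (x : ↥U) => if Disjoint (u : Finset β) x then (1 : ℤ) else 0)ᵀ *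
      (Matrix.diagonal fun (u : ↥D) => (-1 : ℤ) ^ #(u : Finset β)) *
      (Matrix.of fun (u : ↥D) (x : ↥U) => if Disjoint (u : Finset β) x then (1 : ℤ) else 0)
      = (-1 : ℤ) ^ k • Matrix.of fun (x x' : ↥U) => ((Fintype.card β - 1 - #((x : Finset β) ∪ x')).choose k : ℤ) := by
  ext x x'
  rw [Matrix.smul_apply, smul_eq_mul, Matrix.mul_apply]
  simp only [Matrix.mul_diagonal, transpose_apply, of_apply]
  set t : Finset β := ((x : Finset β) ∪ x')ᶜ with htdef
  have hxx' : #((x : Finset β) ∪ x') ≤ 2 * k :=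
    (Finset.card_union_le _ _).trans (by have := hUk x x.2; have := hUk x' x'.2; omega)
  have htcard : #t = Fintype.card β - #((x : Finset β) ∪ x') := by rw [htdef, Finset.card_compl]
  have htne : t.Nonempty := by
    rw [← Finset.card_pos, htcard]; omega
  -- the members of `D` disjoint from `x ∪ x'` are the subsets of `t` of size `≤ k`
  have hfilt : D.filter (fun u => u ⊆ t) = t.powerset.filter (fun u => #u ≤ k) := by
    ext u
    simp only [mem_filter, mem_powerset]
    constructor
    · exact fun h => ⟨h.2, hDk u h.1⟩
    · intro h
      refine ⟨hsh u h.2 x x.2 ?_, h.1⟩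
      have hux : Disjoint u ((x : Finset β) ∪ x') := by
        rw [← Finset.subset_compl_iff_disjoint_right]; exact h.1
      exact Finset.disjoint_union_right.1 hux |>.1
  calc ∑ u : ↥D, ((if Disjoint (u : Finset β) x then (1 : ℤ) else 0) * (-1 : ℤ) ^ #(u : Finset β) *
            (if Disjoint (u : Finset β) x' then (1 : ℤ) else 0))
      = ∑ u ∈ D, ((if Disjoint u (x : Finset β) then (1 : ℤ) else 0) * (-1 : ℤ) ^ #u *
            (if Disjoint u (x' : Finset β) then (1 : ℤ) else 0)) := by
        rw [univ_eq_attach]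
        exact Finset.sum_attach D (fun u => (if Disjoint u (x : Finset β) then (1 : ℤ) else 0) * (-1 : ℤ) ^ #u *
            (if Disjoint u (x' : Finset β) then (1 : ℤ) else 0))
    _ = ∑ u ∈ D, (if u ⊆ t then (-1 : ℤ) ^ #u else 0) := by
        apply Finset.sum_congr rfl
        intro u _
        have hiff : u ⊆ t ↔ Disjoint u (x : Finset β) ∧ Disjoint u (x' : Finset β) := by
          rw [htdef, Finset.subset_compl_iff_disjoint_right, Finset.disjoint_union_right]
        by_cases h1 : Disjoint u (x : Finset β) <;> by_cases h2 : Disjoint u (x' : Finset β)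
        · have h3 : u ⊆ t := hiff.2 ⟨h1, h2⟩
          simp [h1, h2, h3]
        · have h3 : ¬ u ⊆ t := fun h => h2 (hiff.1 h).2
          simp [h1, h2, h3]
        · have h3 : ¬ u ⊆ t := fun h => h1 (hiff.1 h).1
          simp [h1, h2, h3]
        · have h3 : ¬ u ⊆ t := fun h => h1 (hiff.1 h).1
          simp [h1, h2, h3]
    _ = ∑ u ∈ D.filter (fun u => u ⊆ t), (-1 : ℤ) ^ #u := (Finset.sum_filter _ _).symm
    _ = ∑ u ∈ t.powerset.filter (fun u => #u ≤ k), (-1 : ℤ) ^ #u := by rw [hfilt]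
    _ = (-1 : ℤ) ^ k * ((#t - 1).choose k : ℤ) := sum_neg_one_pow_powerset_card_le t k htne
    _ = (-1 : ℤ) ^ k * ((Fintype.card β - 1 - #((x : Finset β) ∪ x')).choose k : ℤ) := by
        rw [htcard]
        congr 3
        omega

omit [Fintype β] in
/-- The signed zeta matrix `Zs[u,d] = (−1)^{#u}[u ⊆ d]` of a family `D` is block-triangular with respect to cardinality, its diagonal blocks are
`± 1`, hence `det Zs ≠ 0`. [elementary] -/
theorem det_zetaSigned_ne_zero (D : Finset (Finset β)) :
    (Matrix.of fun (u : ↥D) (d : ↥D) => if (u : Finset β) ⊆ d then (-1 : ℤ) ^ #(u : Finset β) else 0).det ≠ 0 := by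
  set Zs : Matrix ↥D ↥D ℤ := Matrix.of fun (u : ↥D) (d : ↥D) =>
    if (u : Finset β) ⊆ d then (-1 : ℤ) ^ #(u : Finset β) else 0 with hZs
  have hbt : Zs.BlockTriangular (fun d : ↥D => #(d : Finset β)) := by
    intro u d hlt
    simp only [hZs, of_apply]
    rw [if_neg]
    intro hsub
    exact absurd (Finset.card_le_card hsub) (not_le.2 hlt)
  rw [hbt.det]
  apply Finset.prod_ne_zero_iff.2
  intro a _
  have hblock : Zs.toSquareBlock (fun d : ↥D => #(d : Finset β)) a
      = (-1 : ℤ) ^ a • (1 : Matrix {d : ↥D // #(d : Finset β) = a} {d : ↥D // #(d : Finset β) = a} ℤ) := by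
    ext i j
    simp only [Matrix.toSquareBlock_def, Matrix.of_apply, Matrix.smul_apply, Matrix.one_apply, smul_eq_mul, hZs]
    have hi : #((i : ↥D) : Finset β) = a := i.2
    have hj : #((j : ↥D) : Finset β) = a := j.2
    by_cases hij : i = j
    · subst hij
      simp [hi]
    · have hne : ((i : ↥D) : Finset β) ≠ ((j : ↥D) : Finset β) := fun h => hij (Subtype.ext (Subtype.ext h))
      have hns : ¬ ((i : ↥D) : Finset β) ⊆ ((j : ↥D) : Finset β) := fun hsub =>
        hne (Finset.eq_of_subset_of_card_le hsub (by rw [hi, hj]))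
      simp [hns, hij]
  rw [hblock, det_smul, det_one, mul_one]
  exact pow_ne_zero _ (pow_ne_zero _ (by norm_num))

/-- **Determinant criterion (block form).**  Let `U` be a family of finsets of size `≤ k`, `D` a lower set of finsets of size `≤ k` containing every finset of size `≤ k`
disjoint from some member of `U`, and `2k+2 ≤ |β|`.  If the binomial matrix `[C(|β|−1−#(x ∪ x'), k)]_{x,x' ∈ U}` has non-zero determinant, then so has the block
matrix `[[0, Kᵀ],[K, Disj]]` (`K[d,x] = [d ⊆ x]`, `Disj[d,d'] = [d ∩ d' = ∅]`) — the covering matrix of `U ⊔ {dᶜ : d ∈ D}`. [gen 21, memo §1(iii)–(v)] -/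
theorem det_coveringBlocks_ne_zero_of_det_binomial_ne_zero (k : ℕ) (U D : Finset (Finset β))
    (hD : IsLowerSet (D : Set (Finset β))) (hDk : ∀ d ∈ D, #d ≤ k)
    (hsh : ∀ u : Finset β, #u ≤ k → ∀ x ∈ U, Disjoint u x → u ∈ D) (hUk : ∀ x ∈ U, #x ≤ k)
    (hβ : 2 * k + 2 ≤ Fintype.card β)
    (hM : (Matrix.of fun (x x' : ↥U) => ((Fintype.card β - 1 - #((x : Finset β) ∪ x')).choose k : ℤ)).det ≠ 0) :
    (Matrix.fromBlocks (0 : Matrix ↥U ↥U ℤ)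
        (Matrix.of fun (x : ↥U) (d : ↥D) => if (d : Finset β) ⊆ x then (1 : ℤ) else 0)
        (Matrix.of fun (d : ↥D) (x : ↥U) => if (d : Finset β) ⊆ x then (1 : ℤ) else 0)
        (Matrix.of fun (d d' : ↥D) => if Disjoint (d : Finset β) d' then (1 : ℤ) else 0)).det ≠ 0 := by
  -- the players
  set Zs : Matrix ↥D ↥D ℤ := Matrix.of fun (u : ↥D) (d : ↥D) =>
    if (u : Finset β) ⊆ d then (-1 : ℤ) ^ #(u : Finset β) else 0 with hZs
  set N : Matrix ↥D ↥U ℤ := Matrix.of fun (u : ↥D) (x : ↥U) =>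
    if Disjoint (u : Finset β) x then (1 : ℤ) else 0 with hN
  set S : Matrix ↥D ↥D ℤ := Matrix.diagonal fun (u : ↥D) => (-1 : ℤ) ^ #(u : Finset β) with hS
  set K : Matrix ↥D ↥U ℤ := Matrix.of fun (d : ↥D) (x : ↥U) => if (d : Finset β) ⊆ x then (1 : ℤ) else 0 with hK
  set Dj : Matrix ↥D ↥D ℤ := Matrix.of fun (d d' : ↥D) => if Disjoint (d : Finset β) d' then (1 : ℤ) else 0 with hDj
  set M : Matrix ↥U ↥U ℤ := Matrix.of fun (x x' : ↥U) =>
    ((Fintype.card β - 1 - #((x : Finset β) ∪ x')).choose k : ℤ) with hMdef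
  have hKt : (Matrix.of fun (x : ↥U) (d : ↥D) => if (d : Finset β) ⊆ x then (1 : ℤ) else 0) = Kᵀ := by
    ext x d; simp [hK]
  rw [hKt]
  -- identities
  have hK' : Zsᵀ * N = K := zetaSigned_transpose_mul_disj U D hD
  have hDj' : Zsᵀ * S * Zs = Dj := zetaSigned_transpose_mul_sign_mul_zetaSigned D hD
  have hH : Nᵀ * S * N = (-1 : ℤ) ^ k • M := disj_transpose_mul_sign_mul_disj k U D hDk hsh hUk hβ
  have hSS : S * S = 1 := by
    rw [hS, diagonal_mul_diagonal, ← diagonal_one]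
    congr 1
    ext u
    rw [← mul_pow]; norm_num
  -- C = Rᵀ X R
  set R : Matrix (↥U ⊕ ↥D) (↥U ⊕ ↥D) ℤ := Matrix.fromBlocks (1 : Matrix ↥U ↥U ℤ) 0 0 Zs with hR
  set X : Matrix (↥U ⊕ ↥D) (↥U ⊕ ↥D) ℤ := Matrix.fromBlocks (0 : Matrix ↥U ↥U ℤ) Nᵀ N S with hX
  have hC : Matrix.fromBlocks (0 : Matrix ↥U ↥U ℤ) Kᵀ K Dj = Rᵀ * X * R := by
    rw [hR, hX, fromBlocks_transpose, fromBlocks_multiply, fromBlocks_multiply, ← hK', ← hDj']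
    simp [Matrix.transpose_mul, Matrix.mul_assoc]
  -- E X = [[−NᵀSN, 0],[N, S]]
  set E : Matrix (↥U ⊕ ↥D) (↥U ⊕ ↥D) ℤ := Matrix.fromBlocks (1 : Matrix ↥U ↥U ℤ) (-(Nᵀ * S)) 0 (1 : Matrix ↥D ↥D ℤ)
    with hE
  have hEX : E * X = Matrix.fromBlocks (-(Nᵀ * S * N)) 0 N S := by
    rw [hE, hX, fromBlocks_multiply]
    have h12 : (1 : Matrix ↥U ↥U ℤ) * Nᵀ + -(Nᵀ * S) * S = 0 := by
      rw [Matrix.one_mul, Matrix.neg_mul, Matrix.mul_assoc, hSS, Matrix.mul_one, add_neg_cancel]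
    rw [h12]
    simp [Matrix.neg_mul]
  have hdetE : E.det = 1 := by rw [hE, det_fromBlocks_zero₂₁, det_one, det_one, mul_one]
  have hdetX : X.det = (-(Nᵀ * S * N)).det * S.det := by
    have := congrArg Matrix.det hEX
    rwa [det_mul, hdetE, one_mul, det_fromBlocks_zero₁₂] at this
  have hdetS : S.det ≠ 0 := by
    rw [hS, det_diagonal]
    exact Finset.prod_ne_zero_iff.2 fun u _ => pow_ne_zero _ (by norm_num)
  have hdetZs : Zs.det ≠ 0 := det_zetaSigned_ne_zero D
  have hdetR : R.det ≠ 0 := by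
    rw [hR, det_fromBlocks_zero₂₁, det_one, one_mul]; exact hdetZs
  have hdetH : (-(Nᵀ * S * N)).det ≠ 0 := by
    rw [det_neg, hH, det_smul]
    refine mul_ne_zero (pow_ne_zero _ (by norm_num)) (mul_ne_zero (pow_ne_zero _ (pow_ne_zero _ (by norm_num))) ?_)
    exact hM
  rw [hC, det_mul, det_mul, det_transpose, hdetX]
  exact mul_ne_zero (mul_ne_zero hdetR (mul_ne_zero hdetH hdetS)) hdetR

end Summit.CriticalPhenomena.PercolationContinuityZ3.Theorems.AntiBandCoveringDet
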